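import Summits.AtomisticToContinuum.HydrodynamicLimit.Theses.CollisionIsometryCLT

/-!
# Line `contact-source-duhamel` for the crux `AdaptedWeightCLT` (stmt-AtomisticToContinuum-12949)

Route `CollisionIsometryCLT`, crux rank 2 (the route's hardest item):
`∀ profiles ∃ σ₀ ∀ σ < σ₀ ∀ Φ, H1(σ,Φ) → H2(σ,Φ) → C(σ,Φ)` with
H1 = the conclusion of `DiffuseBackwardInfluence` (mean inverse participation ratio of the
frozen-geometry velocity transfer `M` over every admissible kinetic window tends to `0`),
H2 = component (i) of `AprioriBounds` (time-averaged one-particle exponential velocity moment),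
C = the conclusion of the target `FastMomentRelaxation` (the block traceless kinetic stress `D` and
the block kinetic heat flux `q` vanish in `L²([0,t] × 𝕋³)` in probability, all `t > 0`, `γ ≤ 1/15`).

## The lever (crux idea `contact-source-duhamel`, triage r1: pass ×3; merged with
## `impulse-stress-contraction` = the provider of this line's `stub_columnDepolarisation`)

NO CLT. The Euler kinetic closure consumes only two polynomials of the peculiar velocities
`y = v − ū` — the traceless second moment `D` (rank 2) and the vector third moment `q` (rank 3) —
and along a hard-sphere path the one-particle tensors `Y_i = y_i^{⊗r}` obey an EXACT inhomogeneous
LINEAR recursion collision by collision: at a collision `(i, j, n)`, `P = nnᵀ/|n|²`, `Q = 1 − P`,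
`y_i⁺ = Q y_i + P y_j`, hence (binomial expansion)
  `Y_i⁺ = Q^{⊗r} Y_i + P^{⊗r} Y_j + S_c^{(i)}`,  `S_c^{(i)}` = the CROSS TERMS (≥ 1 factor of each of `Qy_i`, `Py_j`).
Iterating ("variation of constants", `stub_duhamel`): the block moment at time `s` is the INCOHERENT
(decoupled-power) transport `𝒯` of the window-start tensors plus the window sum of transported
contact sources,
  `Σ_i w_i ⟨C, Y_i(s)⟩ = PAST + Ξ`,  `PAST = Σ_i w_i ⟨C, (𝒯_{0→m} Y(s−Δ))_i⟩`,
  `Ξ = Σ_{collisions c in the window} Σ_i w_i ⟨C, (𝒯_{c→m} S_c)_i⟩`.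
* PAST is killed pathwise-in-geometry by COLUMN DEPOLARISATION of `𝒯` (rank 2: the forward impulse
  cloud's stress tends to `|a|²𝟙/3`, so traceless tests see nothing; rank 3: the cloud's cubic tensor
  tends to `0` — spin-1 suppression, which is what diffuseness pays for) plus the tails H2
  (`stub_columnDepolarisation` ⇐ H1 + one-step normal non-degeneracy; `stub_pastDamping`).
* Ξ is compared with its CHAOS VALUE `Ξ^ch` (each source replaced by its average over an independent
  pair drawn from the `|g·n|`-weighted product of the block's current empirical velocity law, GIVEN the
  realised normal): `stub_contactCrossNull` (CCN) says `Ξ − Ξ^ch → 0` in `L²ₜ,ₓ` in probability — the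
  Stosszahlansatz in its weakest moment form: bilinear/cubic, colliding pairs only, one memory back,
  equilibrium-exact (orthogonal Gaussian components are independent; no `O(σ³)` static defect).
* The chaos value is a RESTORING force: for a Gaussian local law `N(0, θ(𝟙+A))`,
  `E[(y_j·n̂) Q y_i | n̂, flux] = −(θ/2) Q A n̂` for EVERY `n̂`, so `⟨A, E S⟩ = −θ(|An̂|² − (n̂ᵀAn̂)²) ≤ 0`
  (zero iff isotropic; identically zero without flux bias — the source's chaos value IS the adapted
  selection, priced rather than wished away); with the pulled-back tests depolarising along each
  particle's later collisions (mean `(3/5)^a`) the correlation of the chaos value with the current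
  block moments is `≈ −½(|D|²+|q|²)`: `stub_sourceContraction` asks only `≤ κ(|D|²+|q|²) + o(1)` for
  some `κ < 1` — the line's CLOSURE statement and its openly named debt (hard-sphere moments do not
  close deterministically: the claim is along the flow, in probability).
* `stub_reduction` (measure theory): `|D|²+|q|² = Σ_b Blk_b (PAST_b + Ξ_b)
  ≤ 2ηΣBlk² + (4η)⁻¹Σ(PAST² + (Ξ−Ξ^ch)²) + Σ Blk·Ξ^ch`, so `(1 − κ − 2η)∫∫(|D|²+|q|²) ≤ o(1)` in
  probability: C.
The line window is `Δℓ_N = (N+1)^{-1/3} log(N+2)` (`n_N ≍ σ² log N → ∞` collisions per particle,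
`N^{3γ} Δℓ_N → 0` for every `γ ≤ 1/15`); for `s < Δℓ_N` the window has length `0` (no negative times:
there PAST is the block moment itself and the initial layer is priced by H2 inside `stub_pastDamping`).

## Composition (kernel-checked, sorry-free)
`AdaptedWeightCLT_of : stub_duhamel → stub_flowDictionary → stub_columnDepolarisation →
stub_pastDamping → stub_contactCrossNull → stub_sourceContraction → stub_reduction →
CollisionIsometryCLT.AdaptedWeightCLT` (D-0027 §3.3 shape: `def stub_x : Prop := type_of% Holds.stub_x`;
`σ₀ := min (min σ_CD σ_CCN) (min σ_SC 2⁻¹)`; H1 enters `stub_columnDepolarisation` (and is offered to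
CCN/SC), H2 enters `stub_pastDamping`, CCN, SC and the reduction; the crux's `let M; let ipr` are this
file's `transferSteps … (steps …)` / `iprF` by ζδ-reduction, its conclusion is `CruxTail` verbatim).

## Disproof used (`Cruxes/AdaptedWeightCLT/Disproof.lean`, cdisprove cycle 1: NO KILL)
§1 `adaptedWeightCLT_of_fastMomentRelaxation`, `withoutDiffuse/withoutTails_of_fastMomentRelaxation`:
no `_false_without_` theorem exists; both hypotheses are nevertheless USED here (H1 at
`stub_columnDepolarisation`, H2 at `stub_pastDamping`/CCN/SC/reduction). §3 toys (landed as
`Theorems/AdaptedWeightCLT/Negative/MechanismToys.lean`, p73057): I1 `diffuse_rows_need_not_isotropise`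
— honoured: isotropy is never inferred from `ipr`; it is the typed column depolarisation `cd2` of the
reflection-generated transport (the isoBlock rows are not reflection products: they violate
`Σ_k M_ik = 𝟙 = Σ_i M_ik`); I2 `adapted_unit_rows_need_not_centre` — honoured: no CLT/Lindeberg step is
run, adaptedness is kept exactly inside `Ξ` and priced by CCN at contact; S4 `one_reflection_covariance`
(7/15 self, 2/15 partner) — these are the depolarisation constants behind `κ`; §2 `ipr_of_collisionCount_eq_zero`
— consistent: with no collisions `𝒯 = id`, no sources, PAST = the block moment, nothing is claimed.
No stub is an instance of a landed Negative lemma (all are statements along the local-Gibbs flow or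
exact algebra).
-/

namespace Summit.AtomisticToContinuum.HydrodynamicLimit.Cruxes.AdaptedWeightCLT.ContactSourceDuhamel

open scoped BigOperators Topology Classical MeasureTheory ENNReal InnerProductSpace
open Filter Set MeasureTheory

noncomputable section

/-! ## Types -/

abbrev T3 : Type := UnitAddTorus (Fin 3)
/-- Velocity space `ℝ³`. -/
abbrev V3 : Type := EuclideanSpace ℝ (Fin 3)
/-- Phase space of `N + 1` spheres on `𝕋³` (the crux's configuration type). -/
abbrev Cfg (N : ℕ) : Type := Literature.Analysis.FluidPDE.Config (N + 1) (Fin 3) T3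
/-- Velocity fields of `N + 1` spheres. -/
abbrev Vel (N : ℕ) : Type := Fin (N + 1) → V3
/-- A hard-sphere flow of `N + 1` spheres of diameter `hsDiameter σ N` on `𝕋³`. -/
abbrev Flow (σ : ℝ) (N : ℕ) : Type :=
  Literature.Analysis.FluidPDE.HardSphereFlow (Literature.Analysis.FluidPDE.Torus.geometry (Fin 3))
    (Literature.MathematicalPhysics.KineticTheory.hsDiameter σ N) (N + 1)
/-- Families of hard-sphere flows at reduced density `σ` (the crux's `Φ`). -/
abbrev Flows (σ : ℝ) : Type := (N : ℕ) → Flow σ N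
/-- `3 × 3` real matrices as functions (entries of the projections `P`, `Q`). -/
abbrev Mat3 : Type := Fin 3 → Fin 3 → ℝ
/-- Rank-`r` tensors on `ℝ³` as functions of a multi-index `Fin r → Fin 3` (`r = 2`: the stress
channel, `r = 3`: the heat-flux channel; one set of definitions serves both). -/
abbrev Tens (r : ℕ) : Type := (Fin r → Fin 3) → ℝ

/-! ## The crux's fold, step by step (verbatim `let`s of the crux; same names as the sibling line
`DiffuseBackwardInfluence/Lines/kinship-lyapunov.lean`) -/

def pre (σ : ℝ) (N : ℕ) (y : Cfg N) (k : ℕ) : Cfg N :=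
  Literature.Analysis.FluidPDE.freeFlight (Literature.Analysis.FluidPDE.Torus.geometry (Fin 3))
    (Literature.Analysis.FluidPDE.Alexander.freeExitTime
      (Literature.Analysis.FluidPDE.Torus.geometry (Fin 3))
      (Literature.MathematicalPhysics.KineticTheory.hsDiameter σ N)
      (Literature.Analysis.FluidPDE.Alexander.stateAfter
        (Literature.Analysis.FluidPDE.Torus.geometry (Fin 3))
        (Literature.MathematicalPhysics.KineticTheory.hsDiameter σ N) y k)).toReal
    (Literature.Analysis.FluidPDE.Alexander.stateAfter
      (Literature.Analysis.FluidPDE.Torus.geometry (Fin 3))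
      (Literature.MathematicalPhysics.KineticTheory.hsDiameter σ N) y k)

/-- One fold step of the crux's transfer: the velocity part of `collidePair` at the realised incoming
pair of `pre k` (the identity if there is none), applied to a velocity field `W` placed at the positions
of `pre k` (verbatim the crux's `fun W' k => dite …`). -/
def stepMap (σ : ℝ) (N : ℕ) (y : Cfg N) (k : ℕ) (W : Vel N) : Vel N :=
  @dite (Fin (N + 1) → EuclideanSpace ℝ (Fin 3))
    (Literature.Analysis.FluidPDE.Alexander.incomingPairs
      (Literature.Analysis.FluidPDE.Torus.geometry (Fin 3))
      (Literature.MathematicalPhysics.KineticTheory.hsDiameter σ N) (pre σ N y k)).Nonempty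
    (Classical.propDecidable _)
    (fun h => fun i => (Literature.Analysis.FluidPDE.collidePair
      (Literature.Analysis.FluidPDE.Torus.geometry (Fin 3)) h.some.1 h.some.2
      (fun j => ((pre σ N y k j).1, W j)) i).2)
    (fun _ => W)

/-- The transfer after the first `m` fold steps; the crux's `M N y Δ W` is
`transferSteps σ N y (steps σ N y Δ) W`. -/
def transferSteps (σ : ℝ) (N : ℕ) (y : Cfg N) (m : ℕ) (W : Vel N) : Vel N :=
  (List.range m).foldl (fun W' k => stepMap σ N y k W') W

/-- The number of fold steps whose collision instant lies in the closed window `[0, s]` (the crux's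
`collisionCount`). -/
def steps (σ : ℝ) (N : ℕ) (y : Cfg N) (s : ℝ) : ℕ :=
  Literature.Analysis.FluidPDE.Alexander.collisionCount
    (Literature.Analysis.FluidPDE.Torus.geometry (Fin 3))
    (Literature.MathematicalPhysics.KineticTheory.hsDiameter σ N) y s

/-- The incoming pair `(i, j)`, `i < j`, reflected at fold step `k` (`none` if the step is the identity). -/
def stepPair (σ : ℝ) (N : ℕ) (y : Cfg N) (k : ℕ) : Option (Fin (N + 1) × Fin (N + 1)) :=
  @dite (Option (Fin (N + 1) × Fin (N + 1)))
    (Literature.Analysis.FluidPDE.Alexander.incomingPairs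
      (Literature.Analysis.FluidPDE.Torus.geometry (Fin 3))
      (Literature.MathematicalPhysics.KineticTheory.hsDiameter σ N) (pre σ N y k)).Nonempty
    (Classical.propDecidable _)
    (fun h => some h.some) (fun _ => none)

/-- The (unnormalised) collision normal of fold step `k`: the separation vector `sepVec xᵢ xⱼ` of the
reflected pair in `pre k` — the direction `collidePair`/`reflectVel` use; `0` if there is no pair. -/
def stepNormal (σ : ℝ) (N : ℕ) (y : Cfg N) (k : ℕ) : V3 :=
  match stepPair σ N y k with
  | none => 0
  | some ij => (Literature.Analysis.FluidPDE.Torus.geometry (Fin 3)).sepVec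
      (pre σ N y k ij.1).1 (pre σ N y k ij.2).1

/-- The crux's mean inverse participation ratio `ipr N y Δ` with its `let M` written as
`transferSteps … (steps …)` (so that H1 is `DiffuseAt` definitionally). -/
def iprF (σ : ℝ) (N : ℕ) (y : Cfg N) (Δ : ℝ) : ℝ :=
  ((N + 1 : ℕ) : ℝ)⁻¹ * ∑ i : Fin (N + 1), ∑ k : Fin (N + 1),
    (∑ a : Fin 3, ‖transferSteps σ N y (steps σ N y Δ)
      (Pi.single k (EuclideanSpace.single a (1 : ℝ))) i‖ ^ 2) ^ 2

/-- The velocities after `m` fold steps: the transfer applied to the velocities of `y` itself (on good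
data these are the actual pre-collisional velocities of step `m`, `stub_flowDictionary`). -/
def velAfter (σ : ℝ) (N : ℕ) (y : Cfg N) (m : ℕ) : Vel N :=
  transferSteps σ N y m (fun i => (y i).2)

/-! ## Tensors -/

/-- The rank-`r` power `y^{⊗r}` of a vector. -/
def tpow (r : ℕ) (y : V3) : Tens r := fun idx => ∏ s : Fin r, y (idx s)

/-- The action `P^{⊗r}` of a matrix on all slots of a rank-`r` tensor. -/
def mapT {r : ℕ} (P : Mat3) (T : Tens r) : Tens r :=
  fun idx => ∑ idx' : Fin r → Fin 3, (∏ s : Fin r, P (idx s) (idx' s)) * T idx'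

/-- The Euclidean pairing of two rank-`r` tensors. -/
def pairT {r : ℕ} (C T : Tens r) : ℝ := ∑ idx : Fin r → Fin 3, C idx * T idx

/-- The squared Frobenius norm of a rank-`r` tensor. -/
def normSqT {r : ℕ} (T : Tens r) : ℝ := ∑ idx : Fin r → Fin 3, T idx ^ 2

/-- The matrix of the normal projection `P = n nᵀ/|n|²` (`0` at `n = 0`). -/
def projM (n : V3) : Mat3 := fun a b => n a * n b / ‖n‖ ^ 2
/-- The matrix of the tangential projection `Q = 𝟙 − P` (`𝟙` at `n = 0`). -/
def coprojM (n : V3) : Mat3 := fun a b => (if a = b then 1 else 0) - n a * n b / ‖n‖ ^ 2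
/-- `P y = (⟪n, y⟫/|n|²) n` — the normal component (as in `reflectVel`; `0` at `n = 0`). -/
def projV (n y : V3) : V3 := (inner ℝ n y / ‖n‖ ^ 2) • n
/-- `Q y = y − P y` — the tangential component. -/
def coprojV (n y : V3) : V3 := y - projV n y

/-- The CROSS TERMS of the binomial expansion of `(Qa + Pb)^{⊗r}`: the sum over the non-trivial subsets
`S` of slots of the tensor with `Pb` in the slots of `S` and `Qa` elsewhere, so that
`(Qa + Pb)^{⊗r} = (Qa)^{⊗r} + (Pb)^{⊗r} + crossT r (Qa) (Pb)` (rank 2: `Qa ⊗ Pb + Pb ⊗ Qa`; rank 3: the six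
mixed terms). This is the contact SOURCE of the line. -/
def crossT (r : ℕ) (qa pb : V3) : Tens r :=
  fun idx => ∑ S ∈ (Finset.univ : Finset (Finset (Fin r))).filter (fun S => S ≠ ∅ ∧ S ≠ Finset.univ),
    ∏ s : Fin r, (if s ∈ S then pb (idx s) else qa (idx s))

/-! ## Incoherent transport, sources, chaos values -/

/-- One step of the INCOHERENT (decoupled-power) transport `𝒯` of a family of rank-`r` tensors along
the fold: at a step reflecting `(i, j)` with normal `n`, `Tᵢ ↦ Q^{⊗r}Tᵢ + P^{⊗r}Tⱼ`,
`Tⱼ ↦ Q^{⊗r}Tⱼ + P^{⊗r}Tᵢ`, all other particles unchanged; the identity at an identity step. Linear,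
positivity-preserving on rank-2 families, trace-preserving (`tr(QTQ + PTP) = tr T`). -/
def tStep (r : ℕ) (σ : ℝ) (N : ℕ) (y : Cfg N) (k : ℕ) (T : Fin (N + 1) → Tens r) :
    Fin (N + 1) → Tens r :=
  match stepPair σ N y k with
  | none => T
  | some ij =>
    Function.update (Function.update T ij.1
        (mapT (coprojM (stepNormal σ N y k)) (T ij.1) + mapT (projM (stepNormal σ N y k)) (T ij.2)))
      ij.2 (mapT (coprojM (stepNormal σ N y k)) (T ij.2) + mapT (projM (stepNormal σ N y k)) (T ij.1))

/-- The incoherent transport through the fold steps `m₁, m₁ + 1, …, m₁ + n − 1`. -/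
def tTransport (r : ℕ) (σ : ℝ) (N : ℕ) (y : Cfg N) (m₁ n : ℕ) (T : Fin (N + 1) → Tens r) :
    Fin (N + 1) → Tens r :=
  (List.range' m₁ n).foldl (fun T' k => tStep r σ N y k T') T

/-- The contact SOURCE family of fold step `l` (shift `u`): at the reflected pair `(i, j)` with normal
`n` and pre-collisional shifted velocities `yᵢ = velAfter l i − u`, `yⱼ = velAfter l j − u`, particle `i`
carries `crossT r (Q yᵢ) (P yⱼ)` and particle `j` carries `crossT r (Q yⱼ) (P yᵢ)`; zero elsewhere and
at identity steps. -/
def src (r : ℕ) (σ : ℝ) (N : ℕ) (y : Cfg N) (u : V3) (l : ℕ) : Fin (N + 1) → Tens r :=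
  match stepPair σ N y l with
  | none => 0
  | some ij =>
    Function.update (Function.update 0 ij.1
        (crossT r (coprojV (stepNormal σ N y l) (velAfter σ N y l ij.1 - u))
          (projV (stepNormal σ N y l) (velAfter σ N y l ij.2 - u))))
      ij.2 (crossT r (coprojV (stepNormal σ N y l) (velAfter σ N y l ij.2 - u))
          (projV (stepNormal σ N y l) (velAfter σ N y l ij.1 - u)))

/-- The CHAOS VALUE of a contact source given the realised normal `n`: the average of
`crossT r (Q ỹ) (P ỹ')` over an independent pair `(ỹ, ỹ')` drawn from the product of the weighted
empirical (shifted) velocity law `Σ_k w_k δ_{W_k − u}` with the hard-sphere FLUX weight `|⟪W_k − W_k', n⟫|`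
(the unnormalised normal only rescales numerator and denominator alike; `0/0 = 0`). -/
def chaosCross (r : ℕ) (N : ℕ) (w : Fin (N + 1) → ℝ) (W : Vel N) (u n : V3) : Tens r :=
  fun idx =>
    (∑ k : Fin (N + 1), ∑ k' : Fin (N + 1),
        w k * w k' * |inner ℝ (W k - W k') n| *
          crossT r (coprojV n (W k - u)) (projV n (W k' - u)) idx) /
      (∑ k : Fin (N + 1), ∑ k' : Fin (N + 1), w k * w k' * |inner ℝ (W k - W k') n|)

/-- The chaos-value source family of fold step `l`: the tensor `chaosCross` of the block law
(weights `w`, velocities `velAfter l`, shift `u`, realised normal) placed at both reflected particles. -/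
def srcCh (r : ℕ) (σ : ℝ) (N : ℕ) (y : Cfg N) (w : Fin (N + 1) → ℝ) (u : V3) (l : ℕ) :
    Fin (N + 1) → Tens r :=
  match stepPair σ N y l with
  | none => 0
  | some ij =>
    Function.update (Function.update 0 ij.1
        (chaosCross r N w (velAfter σ N y l) u (stepNormal σ N y l)))
      ij.2 (chaosCross r N w (velAfter σ N y l) u (stepNormal σ N y l))

/-! ## Window functionals of the line (window start `y`, `m` fold steps, weights `w`, shift `u`) -/

/-- The block moment of rank `r` after `m` fold steps, read off the FOLD velocities:
`(N+1)⁻¹ Σ_i w_i ⟨C, (velAfter m i − u)^{⊗r}⟩` (the left-hand side of the Duhamel identity paired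
with the weights; equals `pastF + xiF`). -/
def blkF (r : ℕ) (σ : ℝ) (N : ℕ) (y : Cfg N) (m : ℕ) (w : Fin (N + 1) → ℝ) (u : V3) (C : Tens r) : ℝ :=
  ((N + 1 : ℕ) : ℝ)⁻¹ * ∑ i : Fin (N + 1), w i * pairT C (tpow r (velAfter σ N y m i - u))

/-- PAST: the transported window-start tensors paired with the weighted test,
`(N+1)⁻¹ Σ_i w_i ⟨C, (𝒯_{0→m} ((y_k).2 − u)^{⊗r})_i⟩`. -/
def pastF (r : ℕ) (σ : ℝ) (N : ℕ) (y : Cfg N) (m : ℕ) (w : Fin (N + 1) → ℝ) (u : V3) (C : Tens r) : ℝ :=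
  ((N + 1 : ℕ) : ℝ)⁻¹ * ∑ i : Fin (N + 1),
    w i * pairT C (tTransport r σ N y 0 m (fun k => tpow r ((y k).2 - u)) i)

/-- Ξ: the window sum of transported contact sources paired with the weighted test,
`(N+1)⁻¹ Σ_{l<m} Σ_i w_i ⟨C, (𝒯_{l+1→m} src_l)_i⟩`. -/
def xiF (r : ℕ) (σ : ℝ) (N : ℕ) (y : Cfg N) (m : ℕ) (w : Fin (N + 1) → ℝ) (u : V3) (C : Tens r) : ℝ :=
  ((N + 1 : ℕ) : ℝ)⁻¹ * ∑ l ∈ Finset.range m, ∑ i : Fin (N + 1),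
    w i * pairT C (tTransport r σ N y (l + 1) (m - (l + 1)) (src r σ N y u l) i)

/-- Ξ^ch: the same window sum with every source replaced by its chaos value `srcCh`. -/
def xiChF (r : ℕ) (σ : ℝ) (N : ℕ) (y : Cfg N) (m : ℕ) (w : Fin (N + 1) → ℝ) (u : V3) (C : Tens r) : ℝ :=
  ((N + 1 : ℕ) : ℝ)⁻¹ * ∑ l ∈ Finset.range m, ∑ i : Fin (N + 1),
    w i * pairT C (tTransport r σ N y (l + 1) (m - (l + 1)) (srcCh r σ N y w u l) i)

/-! ## Column depolarisation functionals (rank 2: distance of the impulse cloud's stress to `|a|²𝟙/3`;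
rank 3: norm of the cloud's cubic tensor), over the six directions `(e_p + e_q)/‖e_p + e_q‖` -/

/-- The coordinate vector `e_p`. -/
def baseV (p : Fin 3) : V3 := EuclideanSpace.single p (1 : ℝ)
/-- The six probe directions `(e_p + e_q)/‖e_p + e_q‖` (`e_p` for `p = q`): their rank-one squares span
the symmetric matrices, so depolarisation along them controls every injected impulse tensor. -/
def dirV (p q : Fin 3) : V3 := (‖baseV p + baseV q‖)⁻¹ • (baseV p + baseV q)
/-- The depolarised rank-2 value `|a|² 𝟙/3` of an impulse `a`. -/
def iso2 (a : V3) : Tens 2 := fun idx => if idx 0 = idx 1 then ‖a‖ ^ 2 / 3 else 0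

/-- The impulse CLOUD tensor: inject `a^{⊗r}` at particle `k`, transport it incoherently through the
first `m` fold steps, and sum over all carriers (rank 2: the impulse-gas stress `J_k(a)`, trace `|a|²`). -/
def cloud (r : ℕ) (σ : ℝ) (N : ℕ) (y : Cfg N) (m : ℕ) (k : Fin (N + 1)) (a : V3) : Tens r :=
  ∑ i : Fin (N + 1), tTransport r σ N y 0 m (Pi.single k (tpow r a)) i

/-- Rank-2 COLUMN DEPOLARISATION functional over the window `[0, Δ]`: the mean over injection sites and
probe directions of `‖cloud − |a|²𝟙/3‖²` (bounded by `2/3 · 9`). -/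
def cd2 (σ : ℝ) (N : ℕ) (y : Cfg N) (Δ : ℝ) : ℝ :=
  ((N + 1 : ℕ) : ℝ)⁻¹ * ∑ k : Fin (N + 1), ∑ p : Fin 3, ∑ q : Fin 3,
    normSqT (cloud 2 σ N y (steps σ N y Δ) k (dirV p q) - iso2 (dirV p q))

/-- Rank-3 column depolarisation functional: the mean over injection sites and probe directions of the
squared norm of the cubic cloud tensor (spin-1 suppression target; bounded by `9`). -/
def cd3 (σ : ℝ) (N : ℕ) (y : Cfg N) (Δ : ℝ) : ℝ :=
  ((N + 1 : ℕ) : ℝ)⁻¹ * ∑ k : Fin (N + 1), ∑ p : Fin 3, ∑ q : Fin 3,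
    normSqT (cloud 3 σ N y (steps σ N y Δ) k (dirV p q))

/-! ## Tests, line window, flow-side functionals -/

/-- The traceless rank-2 tests `E_{jk} − δ_{jk} 𝟙/3`: paired with `Σ_i w_i y_i ⊗ y_i /(N+1)` they return
the crux's `D … j k` exactly. -/
def C2 (j k : Fin 3) : Tens 2 :=
  fun idx => (if idx 0 = j ∧ idx 1 = k then 1 else 0) - (if j = k ∧ idx 0 = idx 1 then 1 / 3 else 0)
/-- The rank-3 tests `½ δ_{a·} δ_{··}`: `⟨C3 a, y^{⊗3}⟩ = ½ y_a |y|²`, so they return the components of the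
crux's heat flux `q`. -/
def C3 (a : Fin 3) : Tens 3 :=
  fun idx => if idx 0 = a ∧ idx 1 = idx 2 then 1 / 2 else 0

/-- The LINE WINDOW `Δℓ_N = (N+1)^{-1/3} log(N+2)`: admissible (`→ 0`, `Δℓ_N (N+1)^{1/3} → ∞`) and short
enough for the initial layer and the kernel-gradient errors (`N^{4γ} Δℓ_N → 0` for `γ ≤ 1/15`). -/
def Δℓ (N : ℕ) : ℝ := (((N : ℝ) + 1) ^ (-(1 : ℝ) / 3)) * Real.log ((N : ℝ) + 2)
/-- The window length used at time `s`: `Δℓ_N` for `s ≥ Δℓ_N`, and `0` in the initial layer `s < Δℓ_N`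
(no negative times are ever used). -/
def winLen (N : ℕ) (s : ℝ) : ℝ := if s < Δℓ N then 0 else Δℓ N

/-- The window-start configuration `Φ_{s − winLen} z`. -/
def winStart (σ : ℝ) (N : ℕ) (Φ : Flow σ N) (s : ℝ) (z : Cfg N) : Cfg N := Φ.flow (s - winLen N s) z

/-- The block weights at `(s, x)`: `w_i = φ_N(x_i(s) − x)` (positions at the FINAL time `s`). -/
def wgt (σ : ℝ) (N : ℕ) (Φ : Flow σ N) (φ : ℕ → T3 → ℝ) (s : ℝ) (z : Cfg N) (x : T3) : Fin (N + 1) → ℝ :=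
  fun i => φ N ((Φ.flow s z i).1 - x)

/-- The block velocity `ū = m̄/ρ̄` at `(s, x)` (verbatim the crux's `ub`). -/
def ubar (σ : ℝ) (N : ℕ) (Φ : Flow σ N) (φ : ℕ → T3 → ℝ) (s : ℝ) (z : Cfg N) (x : T3) : V3 :=
  (Literature.MathematicalPhysics.KineticTheory.empiricalDensityField (Φ.flow s z) (fun y => φ N (y - x)))⁻¹ •
    Literature.MathematicalPhysics.KineticTheory.empiricalMomentumField (Φ.flow s z) (fun y => φ N (y - x))

/-- `Σ_tests PAST²` at `(s, x)` (both channels), the fold restarted at `winStart` with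
`m = steps (winLen N s)` steps, weights `wgt`, shift `ubar`. -/
def PastSq (σ : ℝ) (N : ℕ) (Φ : Flow σ N) (φ : ℕ → T3 → ℝ) (s : ℝ) (z : Cfg N) (x : T3) : ℝ :=
  (∑ j : Fin 3, ∑ k : Fin 3,
      pastF 2 σ N (winStart σ N Φ s z) (steps σ N (winStart σ N Φ s z) (winLen N s)) (wgt σ N Φ φ s z x)
        (ubar σ N Φ φ s z x) (C2 j k) ^ 2) +
    ∑ a : Fin 3,
      pastF 3 σ N (winStart σ N Φ s z) (steps σ N (winStart σ N Φ s z) (winLen N s)) (wgt σ N Φ φ s z x)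
        (ubar σ N Φ φ s z x) (C3 a) ^ 2

/-! ## Flow-side block functionals -/

/-- The block moment of rank `r` at `(s, x)` read off the FLOW velocities:
`(N+1)⁻¹ Σ_i φ_N(x_i(s) − x) ⟨C, (v_i(s) − ū(s,x))^{⊗r}⟩`; for `C = C2 j k` this is the crux's
`D N s z x j k`, for `C = C3 a` the `a`-component of the crux's `q N s z x` (finite-sum form of the
empirical integrals; `stub_reduction`). -/
def blkFlow (r : ℕ) (σ : ℝ) (N : ℕ) (Φ : Flow σ N) (φ : ℕ → T3 → ℝ) (s : ℝ) (z : Cfg N) (x : T3)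
    (C : Tens r) : ℝ :=
  ((N + 1 : ℕ) : ℝ)⁻¹ * ∑ i : Fin (N + 1),
    wgt σ N Φ φ s z x i * pairT C (tpow r ((Φ.flow s z i).2 - ubar σ N Φ φ s z x))

/-- `|D|² + |q|²` at `(s, x)` in tensor form: `Σ_{jk} blkFlow(C2 j k)² + Σ_a blkFlow(C3 a)²`. -/
def DefectSq (σ : ℝ) (N : ℕ) (Φ : Flow σ N) (φ : ℕ → T3 → ℝ) (s : ℝ) (z : Cfg N) (x : T3) : ℝ :=
  (∑ j : Fin 3, ∑ k : Fin 3, blkFlow 2 σ N Φ φ s z x (C2 j k) ^ 2) +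
    ∑ a : Fin 3, blkFlow 3 σ N Φ φ s z x (C3 a) ^ 2

/-- `Σ_tests (Ξ − Ξ^ch)²` at `(s, x)`: the CHAOS DEFECT of the window source sums (both channels). -/
def XiDevSq (σ : ℝ) (N : ℕ) (Φ : Flow σ N) (φ : ℕ → T3 → ℝ) (s : ℝ) (z : Cfg N) (x : T3) : ℝ :=
  (∑ j : Fin 3, ∑ k : Fin 3,
      (xiF 2 σ N (winStart σ N Φ s z) (steps σ N (winStart σ N Φ s z) (winLen N s)) (wgt σ N Φ φ s z x)
          (ubar σ N Φ φ s z x) (C2 j k) -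
        xiChF 2 σ N (winStart σ N Φ s z) (steps σ N (winStart σ N Φ s z) (winLen N s))
          (wgt σ N Φ φ s z x) (ubar σ N Φ φ s z x) (C2 j k)) ^ 2) +
    ∑ a : Fin 3,
      (xiF 3 σ N (winStart σ N Φ s z) (steps σ N (winStart σ N Φ s z) (winLen N s)) (wgt σ N Φ φ s z x)
          (ubar σ N Φ φ s z x) (C3 a) -
        xiChF 3 σ N (winStart σ N Φ s z) (steps σ N (winStart σ N Φ s z) (winLen N s))
          (wgt σ N Φ φ s z x) (ubar σ N Φ φ s z x) (C3 a)) ^ 2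

/-- `Σ_tests Blk · Ξ^ch` at `(s, x)`: the CORRELATION of the chaos value of the window source sums
with the current visible block moments (`Σ_{jk} D_jk Ξ^ch_{jk} + Σ_a q_a Ξ^ch_a` after the
dictionary). The line's closure statement bounds it above by `κ (|D|² + |q|²)`, `κ < 1`; the
mechanism predicts it NEGATIVE (restoring force). -/
def XiCorr (σ : ℝ) (N : ℕ) (Φ : Flow σ N) (φ : ℕ → T3 → ℝ) (s : ℝ) (z : Cfg N) (x : T3) : ℝ :=
  (∑ j : Fin 3, ∑ k : Fin 3,
      blkFlow 2 σ N Φ φ s z x (C2 j k) *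
        xiChF 2 σ N (winStart σ N Φ s z) (steps σ N (winStart σ N Φ s z) (winLen N s))
          (wgt σ N Φ φ s z x) (ubar σ N Φ φ s z x) (C2 j k)) +
    ∑ a : Fin 3,
      blkFlow 3 σ N Φ φ s z x (C3 a) *
        xiChF 3 σ N (winStart σ N Φ s z) (steps σ N (winStart σ N Φ s z) (winLen N s))
          (wgt σ N Φ φ s z x) (ubar σ N Φ φ s z x) (C3 a)

/-! ## The statements of the line -/

/-- Continuous, positive profiles (the crux's hypotheses on `a₀, θ₀, u₀`). -/
def NiceProfiles (a₀ θ₀ : T3 → ℝ) (u₀ : T3 → V3) : Prop :=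
  Continuous a₀ ∧ Continuous θ₀ ∧ Continuous u₀ ∧ (∀ x, 0 < a₀ x) ∧ (∀ x, 0 < θ₀ x)

/-- Admissible kernel families (verbatim the crux's kernel hypothesis at `(γ, C, φ)`). -/
def AdmissibleKernel (γ C : ℝ) (φ : ℕ → T3 → ℝ) : Prop :=
  (∀ N, Literature.Analysis.FunctionSpaces.Torus.IsSmooth (φ N)) ∧ (∀ N y, 0 ≤ φ N y) ∧ (∀ N, ∫ y, φ N y = 1) ∧ (∀ (N : ℕ) y, ((N : ℝ) + 1) ^ (-γ) ≤ Literature.Analysis.FluidPDE.Torus.euclidDist y 0 → φ N y = 0) ∧ (∀ (N : ℕ) y, φ N y ≤ C * ((N : ℝ) + 1) ^ (3 * γ)) ∧ (∀ (N : ℕ) y, ‖Literature.Analysis.FunctionSpaces.Torus.gradient (φ N) y‖ ≤ C * ((N : ℝ) + 1) ^ (4 * γ))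

/-- **VARIATION OF CONSTANTS along the collision sequence** (exact algebra of the typed fold, all
ranks `r ≥ 1`; at `r = 0` the binomial split `1 = 1 + 1` is false, at `r = 1` there are no sources —
momentum conservation): for every `N`, window start `y`, shift `u` and number of fold steps `m`, the family of
rank-`r` powers of the shifted transported velocities equals the incoherent transport of the initial
powers plus the sum over the steps `l < m` of the sources of step `l` transported from step `l+1` on:
`Y^{(m)} = 𝒯_{0→m} Y^{(0)} + Σ_{l<m} 𝒯_{l+1→m} src_l`. -/
def DuhamelIdentity (σ : ℝ) : Prop :=
  ∀ (r N : ℕ) (y : Cfg N) (u : V3) (m : ℕ), 0 < r →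
    (fun i => tpow r (velAfter σ N y m i - u)) =
      tTransport r σ N y 0 m (fun k => tpow r ((y k).2 - u)) +
        ∑ l ∈ Finset.range m, tTransport r σ N y (l + 1) (m - (l + 1)) (src r σ N y u l)

/-- **FLOW DICTIONARY** (the fold IS the flow, almost surely and uniformly in time): for every `N`
and every hard-sphere flow of `N+1` spheres of diameter `hsDiameter σ N` on `𝕋³`, for Liouville-a.e.
`z`, for ALL `s` and `Δ ≥ 0`, the velocities of `Φ_{s+Δ} z` are the crux's transfer over `[0, Δ]`
restarted at `Φ_s z` applied to the velocities of `Φ_s z` (the uniform-in-`s` form of the route's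
support item `TransferRepresentsFlow`, stmt-12952). -/
def FlowDictionary (σ : ℝ) : Prop :=
  ∀ (N : ℕ) (Φ : Flow σ N),
    ∀ᵐ z ∂(Literature.Analysis.FluidPDE.liouville (Literature.Analysis.FluidPDE.Torus.geometry (Fin 3))
      (N + 1) (Literature.MathematicalPhysics.KineticTheory.hsDiameter σ N)),
      ∀ s Δ : ℝ, 0 ≤ Δ →
        (fun i => (Φ.flow (s + Δ) z i).2) = velAfter σ N (Φ.flow s z) (steps σ N (Φ.flow s z) Δ)

/-- H1 at `(σ, profiles, Φ)`: verbatim the crux's first hypothesis (= the conclusion of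
`DiffuseBackwardInfluence`), its `let M; let ipr` written as this file's `iprF`. -/
def DiffuseAt (σ : ℝ) (a₀ θ₀ : T3 → ℝ) (u₀ : T3 → V3) (Φ : Flows σ) : Prop :=
  ∀ Δ : ℕ → ℝ, (∀ N, 0 < Δ N) → Tendsto Δ atTop (𝓝 0) → Tendsto (fun N : ℕ => Δ N * ((N + 1 : ℕ) : ℝ) ^ ((1 : ℝ) / 3)) atTop atTop → ∀ t : ℝ, 0 < t → Tendsto (fun N : ℕ => ∫⁻ z, ENNReal.ofReal (iprF σ N ((Φ N).flow (t - Δ N) z) (Δ N)) ∂(Literature.MathematicalPhysics.KineticTheory.localGibbsLaw σ a₀ u₀ θ₀ N (Φ N))) atTop (𝓝 0)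

/-- H2 at `(σ, profiles, Φ)`: verbatim the crux's second hypothesis (= `AprioriBounds` (i)). -/
def TailsAt (σ : ℝ) (a₀ θ₀ : T3 → ℝ) (u₀ : T3 → V3) (Φ : Flows σ) : Prop :=
  ∀ t : ℝ, 0 < t → ∃ lam Cexp : ℝ, 0 < lam ∧ Tendsto (fun N : ℕ => Literature.MathematicalPhysics.KineticTheory.localGibbsLaw σ a₀ u₀ θ₀ N (Φ N) {z | Cexp < ∫ s in Icc 0 t, ∫ y, Real.exp (lam * ‖y.2‖ ^ 2) ∂(Literature.Analysis.FluidPDE.empiricalMeasure ((Φ N).flow s z))}) atTop (𝓝 0)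

/-- The conclusion of the crux at `(σ, profiles, Φ)`: verbatim its text from `∀ (γ C : ℝ) (φ …)` on
(the `let ρb mb ub D q` telescope included), so that the composition closes by `exact`. -/
def CruxTail (σ : ℝ) (a₀ θ₀ : T3 → ℝ) (u₀ : T3 → V3) (Φ : Flows σ) : Prop :=
  ∀ (γ C : ℝ) (φ : ℕ → (UnitAddTorus (Fin 3)) → ℝ), 0 < γ → γ ≤ 1 / 15 → ((∀ N, Literature.Analysis.FunctionSpaces.Torus.IsSmooth (φ N)) ∧ (∀ N y, 0 ≤ φ N y) ∧ (∀ N, ∫ y, φ N y = 1) ∧ (∀ (N : ℕ) y, ((N : ℝ) + 1) ^ (-γ) ≤ Literature.Analysis.FluidPDE.Torus.euclidDist y 0 → φ N y = 0) ∧ (∀ (N : ℕ) y, φ N y ≤ C * ((N : ℝ) + 1) ^ (3 * γ)) ∧ (∀ (N : ℕ) y, ‖Literature.Analysis.FunctionSpaces.Torus.gradient (φ N) y‖ ≤ C * ((N : ℝ) + 1) ^ (4 * γ))) → let ρb := fun (N : ℕ) (s : ℝ) z (x : UnitAddTorus (Fin 3)) => Literature.MathematicalPhysics.KineticTheory.empiricalDensityField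 ((Φ N).flow s z) (fun y => φ N (y - x)); let mb := fun (N : ℕ) (s : ℝ) z (x : UnitAddTorus (Fin 3)) => Literature.MathematicalPhysics.KineticTheory.empiricalMomentumField ((Φ N).flow s z) (fun y => φ N (y - x)); let ub := fun (N : ℕ) (s : ℝ) z (x : UnitAddTorus (Fin 3)) => (ρb N s z x)⁻¹ • mb N s z x; let D := fun (N : ℕ) (s : ℝ) z (x : UnitAddTorus (Fin 3)) (j k : Fin 3) => (∫ y, φ N (y.1 - x) * ((y.2 j - ub N s z x j) * (y.2 k - ub N s z x k)) ∂(Literature.Analysis.FluidPDE.empiricalMeasure ((Φ N).flow s z))) - (if j = k then (∑ l : Fin 3, ∫ y, φ N (y.1 - x) * (y.2 l - ub N s z x l) ^ 2 ∂(Literature.Analysis.FluidPDE.empiricalMeasure ((Φ N).flow s z))) / 3 else 0); let q := fun (N : ℕ) (s : ℝ) z (x : UnitAddTorus (Fin 3)) => ∫ y, (φ N (y.1 - x) * ‖y.2 - ub N s z x‖ ^ 2 / 2) • (y.2 - ub N s z x) ∂(Literature.Analysis.FluidPDE.empiricalMeasure ((Φ N).flow s z)); ∀ t : ℝ, 0 <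 t → ∀ δ : ℝ, 0 < δ → Tendsto (fun N : ℕ => Literature.MathematicalPhysics.KineticTheory.localGibbsLaw σ a₀ u₀ θ₀ N (Φ N) {z | δ < ∫ s in Icc 0 t, ∫ x, ((∑ j, ∑ k, D N s z x j k ^ 2) + ‖q N s z x‖ ^ 2)}) atTop (𝓝 0)

/-- COLUMN DEPOLARISATION ALONG THE LINE WINDOW at `(σ, profiles, Φ)`: for every `t > 0` the
local-Gibbs mean of `cd2 + cd3` of the incoherent transport over `[t − Δℓ_N, t]` tends to `0`
(rank 2: impulse-cloud stresses reach `|a|²𝟙/3`; rank 3: impulse-cloud cubic tensors vanish). -/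
def CDAlongAt (σ : ℝ) (a₀ θ₀ : T3 → ℝ) (u₀ : T3 → V3) (Φ : Flows σ) : Prop :=
  ∀ t : ℝ, 0 < t → Tendsto (fun N : ℕ => ∫⁻ z, ENNReal.ofReal
      (cd2 σ N ((Φ N).flow (t - Δℓ N) z) (Δℓ N) + cd3 σ N ((Φ N).flow (t - Δℓ N) z) (Δℓ N))
    ∂(Literature.MathematicalPhysics.KineticTheory.localGibbsLaw σ a₀ u₀ θ₀ N (Φ N))) atTop (𝓝 0)

/-- PAST DAMPED at `(σ, profiles, Φ)`: for every admissible kernel family, `t > 0`, `δ > 0`,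
`P(∫₀ᵗ ∫ₓ Σ_tests PAST² > δ) → 0`. -/
def PastSmallAt (σ : ℝ) (a₀ θ₀ : T3 → ℝ) (u₀ : T3 → V3) (Φ : Flows σ) : Prop :=
  ∀ (γ C : ℝ) (φ : ℕ → T3 → ℝ), 0 < γ → γ ≤ 1 / 15 → AdmissibleKernel γ C φ →
    ∀ t : ℝ, 0 < t → ∀ δ : ℝ, 0 < δ →
      Tendsto (fun N : ℕ => Literature.MathematicalPhysics.KineticTheory.localGibbsLaw σ a₀ u₀ θ₀ N (Φ N)
        {z | δ < ∫ s in Icc 0 t, ∫ x, PastSq σ N (Φ N) φ s z x}) atTop (𝓝 0)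

/-- CONTACT CROSS NULL (CCN) at `(σ, profiles, Φ)`: for every admissible kernel family, `t > 0`,
`δ > 0`, `P(∫₀ᵗ ∫ₓ Σ_tests (Ξ − Ξ^ch)² > δ) → 0`. -/
def CrossNullAt (σ : ℝ) (a₀ θ₀ : T3 → ℝ) (u₀ : T3 → V3) (Φ : Flows σ) : Prop :=
  ∀ (γ C : ℝ) (φ : ℕ → T3 → ℝ), 0 < γ → γ ≤ 1 / 15 → AdmissibleKernel γ C φ →
    ∀ t : ℝ, 0 < t → ∀ δ : ℝ, 0 < δ →
      Tendsto (fun N : ℕ => Literature.MathematicalPhysics.KineticTheory.localGibbsLaw σ a₀ u₀ θ₀ N (Φ N)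
        {z | δ < ∫ s in Icc 0 t, ∫ x, XiDevSq σ N (Φ N) φ s z x}) atTop (𝓝 0)

/-- SOURCE CONTRACTION (the closure statement, signed form) at `(σ, profiles, Φ)`: for every
admissible kernel family and `t > 0` there is `κ < 1` such that for every `δ > 0`,
`P(∫₀ᵗ ∫ₓ Σ_tests Blk · Ξ^ch > κ ∫₀ᵗ ∫ₓ (|D|² + |q|²) + δ) → 0` — the chaos value of the source
sums, correlated with the current block stress / heat flux, never exceeds a fraction `κ < 1` of the
visible flux defect (predicted value `κ ≈ −1/2`: a restoring force). -/
def SourceContractionAt (σ : ℝ) (a₀ θ₀ : T3 → ℝ) (u₀ : T3 → V3) (Φ : Flows σ) : Prop :=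
  ∀ (γ C : ℝ) (φ : ℕ → T3 → ℝ), 0 < γ → γ ≤ 1 / 15 → AdmissibleKernel γ C φ →
    ∀ t : ℝ, 0 < t → ∃ κ : ℝ, κ < 1 ∧ ∀ δ : ℝ, 0 < δ →
      Tendsto (fun N : ℕ => Literature.MathematicalPhysics.KineticTheory.localGibbsLaw σ a₀ u₀ θ₀ N (Φ N)
        {z | κ * (∫ s in Icc 0 t, ∫ x, DefectSq σ N (Φ N) φ s z x) + δ <
          ∫ s in Icc 0 t, ∫ x, XiCorr σ N (Φ N) φ s z x}) atTop (𝓝 0)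

/-! ## Registered stubs (`Holds.stub_*`, bodies `sorry`) -/

namespace Holds

/-- STUB 1 (VARIATION OF CONSTANTS, exact algebra, size M). For every `σ` the Duhamel identity of
the typed fold holds for all ranks, all `N`, `y`, `u`, `m`. Ingredients: (i) a fold step is the
identity or `collidePair` at the incoming pair `(i,j)` of `pre k` with normal `n = sepVec xᵢ xⱼ`,
whose velocity part is `reflectVel n`, i.e. `Wᵢ ↦ Q Wᵢ + P Wⱼ`, `Wⱼ ↦ Q Wⱼ + P Wᵢ` with
`P = projV n`, `Q = coprojV n` (and `projV n u + coprojV n u = u` makes the shift `u` pass through);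
(ii) the binomial expansion `tpow r (Q a + P b) = mapT (coprojM n) (tpow r a) + mapT (projM n) (tpow r b)
+ crossT r (Q a) (P b)` (`Finset.prod_add`; `mapT` of a rank-one power is the power of the mapped
vector; at `n = 0` everything is the identity, consistently); (iii) `tStep` is additive in the tensor
family; (iv) induction on `m` (`List.range_succ`, `List.foldl_append`, `Finset.sum_range_succ`,
`List.range'` bookkeeping for `tTransport`). Why plausible: it is an identity (the first lemma of the
idea card, `IdeatorTwoSketch.collision_source_identity`, is its rank-2 one-step case, PROVED). -/
theorem stub_duhamel : ∀ σ : ℝ, DuhamelIdentity σ := by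
  sorry

/-- STUB 2 (FLOW DICTIONARY, size M, provable now). For `0 < σ < 1/2` (so `ε_N < 1/2`: regular
torus geometry) the velocities along every hard-sphere flow are, Liouville-a.s. and simultaneously for
all times `s` and window lengths `Δ ≥ 0`, the typed fold restarted at `Φ_s z` applied to the
velocities of `Φ_s z`. Tools: `HardSphereFlow.isTrajectory` / `flow_add` / `mapsTo_good` /
`measure_compl_good`, uniqueness of hard-sphere trajectories with simple collisions
(`Alexander.torusFlow_isTrajectory/ae_good`-type facts in `HardSphereFlowConstruction`), induction on
`Alexander.collisionCount` (`stateAfter_succ`, `collisionInstant_succ`, `fwdFlow`). This is the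
route's support item `TransferRepresentsFlow` (stmt-12952, "provable-now") in the uniform-in-`s`
form the reduction needs (one null set for all `s`, because the good set is time-independent). -/
theorem stub_flowDictionary : ∀ σ : ℝ, 0 < σ → σ < 2⁻¹ → FlowDictionary σ := by
  sorry

/-- STUB 3 (COLUMN DEPOLARISATION from H1; size L; the content of the merged sibling card
`impulse-stress-contraction`). For all nice profiles there is `σ₀ > 0` such that for `0 < σ < σ₀`
and every flow family, IF the rows of the velocity transfer delocalise on every admissible window
(H1, verbatim) THEN along the line window `Δℓ_N = (N+1)^{-1/3} log(N+2)` (admissible: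
`Δℓ_N (N+1)^{1/3} = log(N+2) → ∞`) the incoherent transport depolarises: `E_LG[cd2 + cd3] → 0` at
every `t > 0`. Mechanism: read `cloud 2 … k a` as the stress `J_k(a)` of an IMPULSE GAS (unit impulse
`a` injected at `k`, split forward by the realised collisions); `pair_stress_update`
(IdeatorTwoSketch, PROVED) averaged over a normal law axially symmetric about the carried piece gives
`E[Δ‖J − |a|²𝟙/3‖² | m] = −c·mᵀ(J − 𝟙/3)m + (c/3)|m|⁴`, `c = 6E[(m̂·ω)²(1−(m̂·ω)²)]` (`4/5` uniform):
a supermartingale DOWN TO THE PARTICIPATION FLOOR, and the floor is H1 (column ipr = row ipr in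
sum); first-order ambient-anisotropy feedback cancels exactly (6th-moment identity, triage-checked).
Rank 3: `|Qa|³ + |Pa|³ < |a|³` strictly off the band/poles, so the cubic cloud norm is slaved to the
piece participation (spin-1 suppression, `IdeatorTwoSketch.spin_one_suppression`): H1 is the
heat-flux half outright. Why it might fail: (a) the RATE needs ONE-STEP NON-DEGENERACY of the
conditional law of the next normal given the coarse past (axial coefficient `c ≥ c₀ > 0`,
N-uniformly along the NON-equilibrium law) — a chaotic-hypothesis-type input shared with the sibling
crux's live line `share-nondegeneracy-one-flight`, not supplied by H1 (Disproof I1/S3: planar or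
coordinate normals freeze components — but those also violate H1); (b) H1 is about the COHERENT
transfer `M`, the functional here is the INCOHERENT transport: on saturated clouds (carrier–carrier
collisions) they differ by mean-zero interferences, measured at the `O(1/N)` floor in the ideator's
toy j008832 (`N·gapJ ≈ 3.4`) but unproved. Sources: IkenberryTruesdell1956
(doi:10.1512/iumj.1956.5.55001), Cercignani1988 App. (A.2), DiaconisSaloffcoste1993, Porod1996
(doi:10.1214/aop/1042644708), CarlenCarvalhoLoss2014 (doi:10.1016/j.jfa.2013.08.024). -/
theorem stub_columnDepolarisation :
    ∀ (a₀ θ₀ : T3 → ℝ) (u₀ : T3 → V3), NiceProfiles a₀ θ₀ u₀ →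
      ∃ σ₀ : ℝ, 0 < σ₀ ∧ ∀ σ : ℝ, 0 < σ → σ < σ₀ →
        ∀ Φ : Flows σ, DiffuseAt σ a₀ θ₀ u₀ Φ → CDAlongAt σ a₀ θ₀ u₀ Φ := by
  sorry

/-- STUB 4 (PAST DAMPING, analysis, size M/L). For nice profiles, `0 < σ < 1/2` and every flow
family: column depolarisation along `Δℓ` and the tails H2 imply `∫₀ᵗ∫ₓ Σ_tests PAST² → 0` in
probability for every admissible kernel family. Proof sketch. Rank 2, `s ≥ Δℓ_N`: by linearity
`PAST(C) = (N+1)⁻¹ Σ_k Σ_{pq} G_k^{pq} (y_k y_kᵀ)_{pq}` with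
`G_k(a) = (N+1)·[w(x_k)⟨C, cloud_k(a)⟩ + Σ_i (w_i − w(x_k))⟨C, 𝒯(δ_k aaᵀ)_i⟩]`; the first term is
`≤ ‖C‖ w(x_k) ‖cloud_k(a) − |a|²𝟙/3‖` because `C2 j k` is TRACELESS (this is where isotropy enters);
the second is `≤ ‖C‖ ‖∇φ_N‖_∞ × (displacement of the cloud ≤ V Δℓ_N + hops·ε_N)` on carriers slower
than `V`, while the test/impulse mass is DOUBLY STOCHASTIC (`𝒯` is positive and fixes the constant
family `𝟙`: `Σ_k tr 𝒯(δ_k aaᵀ)_i` summed over a basis of `a` is `3` for every carrier `i`), so the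
mass ending on carriers faster than `V` is `3 ×` their number fraction, priced by H2 after the
`s`-integration; `N^{4γ} V Δℓ_N → 0`. Then Cauchy–Schwarz with the block weights and the hard-core
density cap `sup_x ρ̄ ≤ 8C/σ³` (at most `(r/ε + 1)³` centres at mutual distance `≥ ε` in a ball of
radius `r`) give `∫ₓ PAST² ≤ C_σ ‖C‖² (N+1)⁻¹Σ_k |y_k|⁴ (dep_k² + grad-err²)`, and
`∫ ds` of it is `≤ (∫ m₈ ds)^{1/2} (∫ E cd2 ds)^{1/2} + …` → 0 in probability (H2 bounds every
time-integrated polynomial moment; `E cd2(s) → 0` pointwise in `s > 0` and is bounded, dominated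
convergence in `s`). Rank 3: same with `‖cloud 3‖ → 0` (`cd3`) in place of tracelessness. Initial
layer `s < Δℓ_N` (zero window, PAST = the block moment itself): `∫ₓ(|D|²+|q|²) ≤ ‖φ_N‖_∞ (m₂² + m₂ m₄)`
and `∫₀^{Δℓ} m₄ ≤ Δℓ V² 2E + C_λ e^{−λV²/2} ∫₀ᵗ(N+1)⁻¹Σ e^{λ|v|²}`, `V² = K log N`, so
`N^{3γ} × (layer) → 0` (`3γ ≤ 1/5 < 1/3`). Why it might fail: only through bookkeeping (Bochner
measurability of the fold functionals along the flow; continuity of `φ_N`); the estimate itself uses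
nothing unproved beyond its two hypotheses. -/
theorem stub_pastDamping :
    ∀ (a₀ θ₀ : T3 → ℝ) (u₀ : T3 → V3), NiceProfiles a₀ θ₀ u₀ →
      ∀ σ : ℝ, 0 < σ → σ < 2⁻¹ → ∀ Φ : Flows σ,
        CDAlongAt σ a₀ θ₀ u₀ Φ → TailsAt σ a₀ θ₀ u₀ Φ → PastSmallAt σ a₀ θ₀ u₀ Φ := by
  sorry

/-- STUB 5 (CONTACT CROSS NULL — the chaos residue; LOAD-BEARING, hardest, size XL). For all nice
profiles there is `σ₀ > 0` such that for `0 < σ < σ₀` and every flow family (H1 and H2 offered as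
hypotheses): along the line window, the window source sums `Ξ` of both channels differ from their
chaos values `Ξ^ch` — every contact source `crossT r (Q yᵢ) (P yⱼ)` replaced by its average over an
independent pair drawn from the `|g·n|`-weighted product of the block's current empirical (shifted)
velocity law GIVEN the realised normal `n` (`chaosCross`) — by `o(1)` in `L²([0,t] × 𝕋³)` in
local-Gibbs probability. This is bilinear (rank 2) / cubic (rank 3) PRE-COLLISIONAL FACTORISATION AT
CONTACT, for colliding pairs only, block × window averaged, with the fluctuation (variance) part of the
source sum INCLUDED (triage r1-1 (a)): `|B| n_N` summands of weight `1/|B|`, damped by the pulled-back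
tests to an effective `O(1)` per particle, so the `L²` statement needs decorrelation ACROSS particles'
contacts, never fairness of one particle's successive kicks. Why easier than ancestor chaos (the card's
Transfer (v)): the pulled-back tests die after `O(1/c₀)` own collisions, so only the last `O(1)`
contacts of each block particle carry weight — the backward history that can correlate a weighted
colliding pair has depth `O(1)` in collision count, N-uniformly; the Euler factor `N^{1/3}` never
enters. Equilibrium-exact: under the invariant Gibbs law orthogonal Gaussian components are
independent, `E[crossT] = 0 = chaosCross + O(N^{-(1−3γ)/2})`, no `O(σ³)` static defect. Why it might
fail: it IS a Stosszahlansatz-class statement along the non-equilibrium law at fixed `σ` for all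
`t > 0` (`BoltzmannHypothesisBarrierNarrow` scope (b): absence of proof, not a counter-theorem) with
two named enemies — (1) RINGS closing within the depolarisation memory (an `O(σ³)`-probability stratum
per contact; its `SO(3)`-equivariant part renormalises the source coefficient, hence `∃ σ₀`), and
(2) SUB-BLOCK COHERENCE (triage r1-2 (F2), r1-3): a mesoscale shear/sound mode at scales
`N^{-1/3} ≪ ℓ ≪ N^{-γ}` makes the block law the wrong comparison (contact pairs share position, the
block law carries the sub-block velocity variance as apparent anisotropy) and CCN then fails by `O(A²)`
deterministically — so the proof needs sub-block quiescence along the flow (`GermanoSplitLES.MesoQuiescence`,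
stmt-9198, typed PRE-SHOCK only; post-shock nobody has a handle: this is the crux's own `∀ t > 0`
exposure, triage crux-level note 1). Tools: BBGKY/pseudo-trajectory expansion over `O(1)` collision
depths at fixed `σ` (GST2013 Part II for the combinatorics; recollision strata
`RecollisionGeometry.measure_setOf_ray_meets_closedBall_le`), H2 for uniform integrability of the
flux weight, Lutsko1996/2001 (doi:10.1103/physrevlett.77.2225, 10.1103/physrevlett.86.3344) for the
Enskog-level evidence that pre-collisional factorisation survives strong shear. -/
theorem stub_contactCrossNull :
    ∀ (a₀ θ₀ : T3 → ℝ) (u₀ : T3 → V3), NiceProfiles a₀ θ₀ u₀ →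
      ∃ σ₀ : ℝ, 0 < σ₀ ∧ ∀ σ : ℝ, 0 < σ → σ < σ₀ →
        ∀ Φ : Flows σ, DiffuseAt σ a₀ θ₀ u₀ Φ → TailsAt σ a₀ θ₀ u₀ Φ →
          CrossNullAt σ a₀ θ₀ u₀ Φ := by
  sorry

/-- STUB 6 (SOURCE CONTRACTION — the closure statement; size L/XL). For all nice profiles there is
`σ₀ > 0` such that for `0 < σ < σ₀` and every flow family (H1, H2 offered): for every admissible kernel
family and `t > 0` some `κ < 1` bounds the correlation of the chaos value of the source sums with the
current block moments, `∫₀ᵗ∫ₓ Σ_b Blk_b Ξ^ch_b ≤ κ ∫₀ᵗ∫ₓ (|D|²+|q|²) + o(1)` in probability.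
Why plausible — the chaos value is a RESTORING FORCE, so the predicted constant is NEGATIVE:
(i) per collision, for a Gaussian block law `N(0, θ(𝟙+A))` and EVERY normal `n̂`,
`chaosCross 2 = −(θ/2)(QAn̂ ⊗ n̂ + n̂ ⊗ QAn̂)` exactly (flux bias `E[(yᵢ·n̂)(yⱼ·n̂) | flux] = −θ_n̂/2`
times Gaussian conditioning `E[Qyᵢ | yᵢ·n̂] = θQAn̂ (yᵢ·n̂)/θ_n̂`; triage-checked, toy j008832:
`nn = −0.50`, `src·A/‖A‖² ≈ −0.4θ` per pair), hence `⟨A, E S^{(i)}⟩ = −θ(|An̂|² − (n̂ᵀAn̂)²) ≤ 0`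
for every `n̂`, `= −(θ/5)‖A‖²` on average (`E[QAn̂ ⊗ n̂] = A/5`) — zero iff isotropic, and with NO
flux bias (blind partners) it would vanish identically: the cross source's chaos value is pure
adaptedness, priced instead of wished away; `chaosCross 3 = 0` for every Gaussian law (the cubic
value is linear in the ODD cumulants, i.e. in `q` at first order); (ii) memory: the pulled-back test
of a source of age `a` own-collisions has MEAN `E[QCQ + PCP]^a = (3/5)^a C` (7/15 kept + 2/15 handed
back through the partner's test, `one_reflection_covariance`, Disproof S4), so in normal-averaged
bookkeeping `Σ_b Blk_b Ξ^ch_b ≈ −(1/5)Σ_a (3/5)^a ⟨D(s), D(s_a)⟩ ≈ −½|D|²` on persistent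
configurations (kernel mass `(1/5)/(1 − 3/5) = 1/2`), i.e. `κ ≈ −1/2`, while on relaxing
configurations both sides are `o(1)`; first-order feedback of the ambient anisotropy into the weights
cancels (`c₁ = 0`, the sibling card's 6th-moment identity), so the kernel is the linearised hard-sphere
`ℓ = 2, 3` relaxation (`hardSphereLinearizedOp_spectralGap_holds` in tree). The UNSIGNED variant
`∫∫Σ(Ξ^ch)² ≤ κ²∫∫(|D|²+|q|²) + o(1)` also closes the reduction but has no margin: Cauchy–Schwarz with
the realised (un-averaged) weights gives rms memory `Σ_a (3/5)^{a/2} ≈ 4.4` times coefficient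
`≈ 0.32`, above `1` — the sign is the lever, not the size. Why it might fail — this stub carries the
line's CLOSURE DEBT, stated openly: (1) the hard-sphere moment hierarchy does not close: a block law
with `D = 0` but an anisotropic FOURTH cumulant has a non-zero flux cross moment (half the mass at
`±a e₁`, half uniform on the circle of radius `√2·a` in `e₁^⊥`: second moments isotropic,
`chaosCross 2 = λ·diag(2,−1,−1) ≠ 0` by `ℤ₂ × O(2)`-equivariance), so no DETERMINISTIC inequality of
this kind holds and the stub is claimed only ALONG THE FLOW, in probability, with `o(1)` slack —
hidden (higher-cumulant, flux-weighted) anisotropy must stay subordinate to the visible one or be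
`o(1)` in `L²ₜ,ₓ`; for Maxwell molecules there is no such debt (IkenberryTruesdell1956), for hard
spheres it is the price of "moments, no entropy" (CarlenCarvalhoLoss2014 pay it with a spectral gap
in `L²`); (2) the weights' orientation fluctuations (mean zero, `O(1)` per particle) must average out
across the block's particles (an LLN over distinct particles' distinct contacts — weak dependence,
never fairness of one particle's kicks) and the ADAPTED normal statistics renormalise `1/5`, `3/5`
(flux selection carries another quarter of the hard-sphere deviator rate, triage r1-1) — the margin
from `−1/2` to `1` is what absorbs both; (3) time variation of `D` within the memory (`O(1)` collision
times) enters through `⟨D(s), D(s_a)⟩`: an oscillation of `D` on the collision time scale would weaken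
the sign (delay-equation effect), but the kernel mass `1/2 < 1` closes even unsigned in mean. Sources:
IkenberryTruesdell1956 (doi:10.1512/iumj.1956.5.55001), Cercignani1988 App. (A.2),
CarlenGeronimoLoss2008 (doi:10.1137/070695423), CarlenCarvalhoLoss2014
(doi:10.1016/j.jfa.2013.08.024), GarzoSantos2003 (USF anisotropy `∝ Kn`, Disproof §6). -/
theorem stub_sourceContraction :
    ∀ (a₀ θ₀ : T3 → ℝ) (u₀ : T3 → V3), NiceProfiles a₀ θ₀ u₀ →
      ∃ σ₀ : ℝ, 0 < σ₀ ∧ ∀ σ : ℝ, 0 < σ → σ < σ₀ →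
        ∀ Φ : Flows σ, DiffuseAt σ a₀ θ₀ u₀ Φ → TailsAt σ a₀ θ₀ u₀ Φ →
          SourceContractionAt σ a₀ θ₀ u₀ Φ := by
  sorry

/-- STUB 7 (REDUCTION, measure theory, size M). For `0 < σ < 1/2` (local Gibbs laws are probability
measures, `isProbabilityMeasure_localGibbsLaw`; `localGibbsLaw ≪ liouville`,
`localGibbsLaw_absolutelyContinuous`, so the dictionary holds LG-a.s. for all `s` at once): the
Duhamel identity, the flow dictionary, H2, past damping, CCN and source contraction imply the crux's
conclusion at `(σ, profiles, Φ)`. Proof: fix an admissible `(γ, C, φ)`, `t`, `δ`. On the a.s. set, for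
every `s ∈ [0, t]` and `x`: the crux's `D N s z x j k = blkFlow 2 … (C2 j k)` and
`(q N s z x) a = blkFlow 3 … (C3 a)` (empirical integrals are `(N+1)⁻¹`-weighted finite sums;
`C2 j k` pairs to the `(j,k)` entry minus the trace part, `C3 a` to `½ yₐ|y|²`), the dictionary turns
`blkFlow` into `blkF` of the fold restarted at `winStart` with `m = steps (winLen N s)` steps
(`sub_add_cancel`), and the Duhamel identity paired with the weights gives `blkF = pastF + xiF` test
by test; hence pointwise
`|D|²+|q|² = Σ_b Blk_b (PAST_b + (Ξ_b − Ξ^ch_b) + Ξ^ch_b) ≤ 2η Σ_b Blk_b² + (4η)⁻¹ Σ_b (PAST_b² + (Ξ_b − Ξ^ch_b)²) + Σ_b Blk_b Ξ^ch_b`.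
Integrate over `[0,t] × 𝕋³`, use source contraction with its `κ < 1` and pick `η` with
`κ + 2η < 1`: `(1 − κ − 2η) ∫∫(|D|²+|q|²) ≤ (4η)⁻¹(P + V) + δ'` outside the three bad events of
`PastSmallAt` (`P`), `CrossNullAt` (`V`), `SourceContractionAt` at levels `∝ δ(1 − κ − 2η)`, plus a
null set (monotonicity and subadditivity of the outer measure — no measurability of the events is
needed; integrability bookkeeping for splitting the Bochner integrals, where the junk-zero convention
can only empty the crux's bad event). -/
theorem stub_reduction :
    ∀ σ : ℝ, 0 < σ → σ < 2⁻¹ → DuhamelIdentity σ → FlowDictionary σ →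
      ∀ (a₀ θ₀ : T3 → ℝ) (u₀ : T3 → V3), NiceProfiles a₀ θ₀ u₀ → ∀ Φ : Flows σ,
        TailsAt σ a₀ θ₀ u₀ Φ → PastSmallAt σ a₀ θ₀ u₀ Φ → CrossNullAt σ a₀ θ₀ u₀ Φ →
          SourceContractionAt σ a₀ θ₀ u₀ Φ → CruxTail σ a₀ θ₀ u₀ Φ := by
  sorry

end Holds

/-! ## Stub statements by name (D-0027 §3.3: the hypotheses of `_of` are these `Prop`s) -/

/-- Statement of registered stub 1 (`Holds.stub_duhamel`), by name. -/
def stub_duhamel : Prop := type_of% Holds.stub_duhamel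
/-- Statement of registered stub 2 (`Holds.stub_flowDictionary`), by name. -/
def stub_flowDictionary : Prop := type_of% Holds.stub_flowDictionary
/-- Statement of registered stub 3 (`Holds.stub_columnDepolarisation`), by name. -/
def stub_columnDepolarisation : Prop := type_of% Holds.stub_columnDepolarisation
/-- Statement of registered stub 4 (`Holds.stub_pastDamping`), by name. -/
def stub_pastDamping : Prop := type_of% Holds.stub_pastDamping
/-- Statement of registered stub 5 (`Holds.stub_contactCrossNull`), by name. -/
def stub_contactCrossNull : Prop := type_of% Holds.stub_contactCrossNull
/-- Statement of registered stub 6 (`Holds.stub_sourceContraction`), by name. -/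
def stub_sourceContraction : Prop := type_of% Holds.stub_sourceContraction
/-- Statement of registered stub 7 (`Holds.stub_reduction`), by name. -/
def stub_reduction : Prop := type_of% Holds.stub_reduction

/-! ## Composition (sorry-free): the seven stubs ⟹ the crux BY NAME -/

/-- **The skeleton theorem.** `σ₀ := min (min σ_CD σ_CCN) (min σ_SC 2⁻¹)`. For `σ < σ₀` and a flow
family `Φ`, after introducing the crux's `let M; let ipr` and its two hypotheses, H1 is this file's
`DiffuseAt` and H2 is `TailsAt` definitionally; stub 7 is fed the algebra (stub 1), the dictionary
(stub 2), H2, past damping (stub 4, itself fed column depolarisation from stub 3 and H1), CCN (stub 5)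
and source contraction (stub 6), and returns `CruxTail σ a₀ θ₀ u₀ Φ` — the crux's conclusion
verbatim. -/
theorem AdaptedWeightCLT_of
    (h1 : stub_duhamel) (h2 : stub_flowDictionary) (h3 : stub_columnDepolarisation)
    (h4 : stub_pastDamping) (h5 : stub_contactCrossNull) (h6 : stub_sourceContraction)
    (h7 : stub_reduction) :
    Summit.AtomisticToContinuum.HydrodynamicLimit.Theses.CollisionIsometryCLT.AdaptedWeightCLT := by
  intro a₀ θ₀ u₀ ha hθ hu ha0 hθ0
  have hP : NiceProfiles a₀ θ₀ u₀ := ⟨ha, hθ, hu, ha0, hθ0⟩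
  have H1 := (h1 : type_of% Holds.stub_duhamel)
  have H2 := (h2 : type_of% Holds.stub_flowDictionary)
  obtain ⟨σ₃, hσ₃, H3⟩ := (h3 : type_of% Holds.stub_columnDepolarisation) a₀ θ₀ u₀ hP
  have H4 := (h4 : type_of% Holds.stub_pastDamping)
  obtain ⟨σ₅, hσ₅, H5⟩ := (h5 : type_of% Holds.stub_contactCrossNull) a₀ θ₀ u₀ hP
  obtain ⟨σ₆, hσ₆, H6⟩ := (h6 : type_of% Holds.stub_sourceContraction) a₀ θ₀ u₀ hP
  have H7 := (h7 : type_of% Holds.stub_reduction)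
  refine ⟨min (min σ₃ σ₅) (min σ₆ 2⁻¹), ?_, ?_⟩
  · exact lt_min (lt_min hσ₃ hσ₅) (lt_min hσ₆ (by norm_num))
  intro σ hσ hlt
  have h3lt : σ < σ₃ := lt_of_lt_of_le hlt ((min_le_left _ _).trans (min_le_left _ _))
  have h5lt : σ < σ₅ := lt_of_lt_of_le hlt ((min_le_left _ _).trans (min_le_right _ _))
  have h6lt : σ < σ₆ := lt_of_lt_of_le hlt ((min_le_right _ _).trans (min_le_left _ _))
  have hhalf : σ < 2⁻¹ := lt_of_lt_of_le hlt ((min_le_right _ _).trans (min_le_right _ _))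
  intro M ipr Φ hH1 hH2
  have hD : DiffuseAt σ a₀ θ₀ u₀ Φ := hH1
  have hT : TailsAt σ a₀ θ₀ u₀ Φ := hH2
  exact H7 σ hσ hhalf (H1 σ) (H2 σ hσ hhalf) a₀ θ₀ u₀ hP Φ hT
    (H4 a₀ θ₀ u₀ hP σ hσ hhalf Φ (H3 σ hσ h3lt Φ hD) hT)
    (H5 σ hσ h5lt Φ hD hT) (H6 σ hσ h6lt Φ hD hT)

/-- D-0027 §3.3 shape: the crux from the registered stubs — an `example`, so that
`AdaptedWeightCLT_of` stays the unique theorem concluding the crux; it becomes the proof of the item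
once the seven `sorry`s are discharged. -/
example : Summit.AtomisticToContinuum.HydrodynamicLimit.Theses.CollisionIsometryCLT.AdaptedWeightCLT :=
  AdaptedWeightCLT_of Holds.stub_duhamel Holds.stub_flowDictionary Holds.stub_columnDepolarisation
    Holds.stub_pastDamping Holds.stub_contactCrossNull Holds.stub_sourceContraction
    Holds.stub_reduction

end

end Summit.AtomisticToContinuum.HydrodynamicLimit.Cruxes.AdaptedWeightCLT.ContactSourceDuhamel
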